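import Mathlib
import Summits.Ventures.PercRepro.TriangleCapHangFamily

/-!
# PercRepro — THE HANG FAMILY ALONG A VERTEX DELETION: the transport of the two shapes of the line
(p3, gen 42; part 173)

The recursion `line_eq_iff` (part 171) hangs a vertex `z` of degree `2` on two vertices of degree `k − 3`
of an extremal graph `D − z` of the line at `k − 1`.  This module carries the two shapes of the line
across that step.  (1) `hangOn_of_del`: if `D − z` is a hang family graph on the core `C'` with the pair
`x', y'` and the neighbours of `z` are exactly `x', y'`, then `D` is a hang family graph on the same core
with the same pair.  (2) `eq_pair_of_deg_of_hangOn`: in a hang family graph on `k ≥ 7` vertices the only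
vertices of degree `k − 3` are `x` and `y` — so the hanging vertex has no choice where to hang.
(3) `star_of_del_star`: if `D − z` is star-shaped (`K_{3, k−4}` minus a star) and `k ≥ 8`, the neighbours of
`z` lie on the small side (a vertex of the large side has degree `≤ 3 < k − 4` there), `D` is a spanning
subgraph of some `K_{3, k−3}` (`bipSub_of_del`), and its extremality makes its missing pairs a star
(`exists_missingStar_of_closed_form_eq`).  Axioms: standard.
-/

namespace PercRepro

namespace TriangleCap

namespace C047

open Finset

variable {V : Type*} [Fintype V] [DecidableEq V]

omit [Fintype V] in
/-- **TRANSPORT OF THE HANG FAMILY:** a hang family graph `D − z` whose pair `x', y'` is exactly the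
neighbourhood of `z` gives a hang family graph `D` on the same core with the same pair. -/
theorem hangOn_of_del (D : SimpleGraph V) [DecidableRel D.Adj] (z : V) {C' : Finset {v : V // v ≠ z}}
    {x' y' : {v : V // v ≠ z}} (h : HangOn (del D z) C' x' y')
    (hz : ∀ w, D.Adj z w ↔ (w = x'.1 ∨ w = y'.1)) :
    HangOn D (C'.map (Function.Embedding.subtype _)) x'.1 y'.1 := by
  obtain ⟨hC, hx, hy, hxy, hcub, hout⟩ := h
  have hmem : ∀ a : {v : V // v ≠ z}, a.1 ∈ C'.map (Function.Embedding.subtype _) ↔ a ∈ C' :=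
    fun a => mem_map' _
  refine ⟨by rw [card_map, hC], (hmem x').mpr hx, (hmem y').mpr hy, fun h => hxy (Subtype.ext h), ?_, ?_⟩
  · intro c hc
    rw [mem_map] at hc
    obtain ⟨c', hc', rfl⟩ := hc
    have := hcub c' hc'
    unfold degIn at this ⊢
    rw [filter_map, card_map]
    convert this using 2
    ext w
    simp only [mem_filter, Function.comp, Function.Embedding.coe_subtype, del_adj]
  · intro w hw u
    by_cases hwz : w = z
    · rw [hwz]
      exact hz u
    · have hw' : (⟨w, hwz⟩ : {v : V // v ≠ z}) ∉ C' := fun h => hw ((hmem ⟨w, hwz⟩).mpr h)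
      by_cases huz : u = z
      · rw [huz]
        constructor
        · intro hadj
          exfalso
          rcases (hz w).mp (D.adj_symm hadj) with h | h
          · exact hw (h ▸ (hmem x').mpr hx)
          · exact hw (h ▸ (hmem y').mpr hy)
        · rintro (h | h)
          · exact absurd h.symm x'.2
          · exact absurd h.symm y'.2
      · have := hout ⟨w, hwz⟩ hw' ⟨u, huz⟩
        rw [del_adj] at this
        simp only [Subtype.ext_iff] at this
        exact this

/-- **THE HANGING HAS NO CHOICE:** in a hang family graph on `k ≥ 7` vertices a vertex of degree `k − 3` is
`x` or `y` (the rest of the core has degree `3`, the vertices off the core degree `2`). -/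
theorem eq_pair_of_deg_of_hangOn (D : SimpleGraph V) [DecidableRel D.Adj] {C : Finset V} {x y : V}
    (h : HangOn D C x y) (hk : 7 ≤ Fintype.card V) {p : V} (hp : deg D p + 3 = Fintype.card V) :
    p = x ∨ p = y := by
  by_cases hpC : p ∈ C
  · have := deg_of_hangOn_mem D h hpC
    by_contra hne
    rw [if_neg hne] at this
    omega
  · have := deg_of_hangOn_not_mem D h hpC
    omega

/-- **TRANSPORT OF THE STAR SHAPE:** for `k ≥ 8`, if `D − z` is star-shaped and the neighbours of `z` have
degree `k − 3`, then an extremal `D` of the line is star-shaped. -/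
theorem star_of_del_star (D : SimpleGraph V) [DecidableRel D.Adj] (hK : K4mFree D) (hk : 8 ≤ Fintype.card V)
    (hm : D.edgeFinset.card + 3 = 2 * Fintype.card V)
    (heq : ∑ v, deg D v * deg D v + (Fintype.card V - 6) * 5 = D.edgeFinset.card * Fintype.card V) (z : V)
    (hnb : ∀ x : {v : V // v ≠ z}, D.Adj x.1 z → deg D x.1 + 3 = Fintype.card V)
    (hstar' : ∃ (A' : Finset {v : V // v ≠ z}) (v' : {v : V // v ≠ z}),
      A'.card = 3 ∧ BipSub (del D z) A' ∧ MissingStar (del D z) A' v') :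
    ∃ (A : Finset V) (v : V), A.card = 3 ∧ BipSub D A ∧ MissingStar D A v := by
  obtain ⟨A', -, hA', hsub', -⟩ := hstar'
  obtain ⟨A, hA, hsub⟩ := bipSub_of_del D hK z 3 A' hA' hsub' hnb (Or.inl (by omega))
  have hcell : D.edgeFinset.card + (Fintype.card V - 6) = 3 * (Fintype.card V - 3) := by omega
  have hr : (Fintype.card V - 6) * (Fintype.card V - 1 - (Fintype.card V - 6)) = (Fintype.card V - 6) * 5 := by
    congr 1
    omega
  rw [← hr] at heq
  obtain ⟨v, hv⟩ := exists_missingStar_of_closed_form_eq D A hsub 3 (Fintype.card V - 6) hA hcell (by omega) heq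
  exact ⟨A, v, hA, hsub, hv⟩

/-- The neighbourhood of a vertex of degree `2`: two distinct vertices `p ≠ q`, both different from it, with
`D.Adj z w ↔ w = p ∨ w = q`. -/
theorem nbhd_of_deg_two (D : SimpleGraph V) [DecidableRel D.Adj] {z : V} (hz : deg D z = 2) :
    ∃ p q, p ≠ q ∧ p ≠ z ∧ q ≠ z ∧ ∀ w, D.Adj z w ↔ (w = p ∨ w = q) := by
  unfold deg at hz
  obtain ⟨p, q, hpq, hN⟩ := card_eq_two.mp hz
  have hzw : ∀ w, D.Adj z w ↔ (w = p ∨ w = q) := by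
    intro w
    have := mem_filter.symm.trans (Iff.of_eq (congrArg (fun s : Finset V => w ∈ s) hN))
    simpa only [mem_univ, true_and, mem_insert, mem_singleton] using this
  refine ⟨p, q, hpq, ?_, ?_, hzw⟩
  · exact (D.ne_of_adj ((hzw p).mpr (Or.inl rfl))).symm
  · exact (D.ne_of_adj ((hzw q).mpr (Or.inr rfl))).symm

end C047

end TriangleCap

end PercRepro
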